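import Literature.NumberTheory.EllipticCurves.Kato2004.DivisibilityInputsMultiplicative
import Literature.NumberTheory.EllipticCurves.Kato2004.ExceptionalPrimeInvolutionTransportProofs
import HarnessLib

/-!
# Kato 2004 §17.13 with an exceptional height-one prime INSIDE the `p`-adic `L`-function: from a
# `MultDivisibilityInputs` package for `L = π · L₀`, the divisibility `ℓ_𝔮(X) ≤ ord_𝔮(L̃₀)` OFF the prime
# `(π)`, and AT `(π)` by transport from `ι(π)` (Greenberg's `ι(char X) = char X` + the functional
# equation `(ι L̃₀) = (L̃₀)`) — PROVED module theory (companion of `DivisibilityInputsMultiplicative` and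
# `ExceptionalPrimeInvolutionTransportProofs`)

K. Kato, Astérisque **295** (2004) [Kato2004Asterisque], Thm. 12.5 (3) (p. 222) with its local term at the
prime `𝔮₀` of (12.5.1), §17.13 (pp. 279–280). A `Kato2004.MultDivisibilityInputs W p L κ γ I D` (the
§17.13 input package of the tree, file `DivisibilityInputsMultiplicative`: `𝐇¹ →loc P →toX X →δ 𝐇² →ε 𝐇²_loc`
exact up to `×p^a`, `col : P ↪ Λ`, `G ∈ col(loc Z)` with `ι G = pⁿ·L`, Thm. 12.5 (3) WITH its local term of
length `≤ 1`) yields, by the tree's `Kato2004.lengthAt_add_le_of_skeleton_exceptional` (the local term cancels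
against the surjectivity of `ε` up to `p^a`), `ℓ_𝔮(X) ≤ ℓ_𝔮(Λ/(G))` at EVERY height-one `𝔮 ∌ p`. When the
Coleman map of the package is only `Λ`-valued after a factor `π` generating a height-one prime — the
situation of an ODD-branch / twisted package whose Perrin-Riou map has colength one at `𝔮₀ = (π)` (cell
`bsd-2adic`, seat `addL2x` GEN 16, crux stmt-BirchSwinnertonDyer-19098: `E` additive at `2` with split
multiplicative twist, `π = T + 4/5`) — one has `L = ι(π)·L₀` and `G ≐ π·L̃₀` (`ι L̃₀ = p^m L₀`), so:

* `MultDivisibilityInputs.lengthAt_X_le_off_factor` — at a height-one `𝔮 ∌ p` NOT containing `π`: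
  **`ℓ_𝔮(X) ≤ ℓ_𝔮(Λ/(L̃₀))`** (the factor `π` is invisible there);
* `MultDivisibilityInputs.lengthAt_X_le_at_factor_of_transport` — at a height-one `𝔮₀ ∌ p` whose
  `ι`-conjugate does not contain `π` (so `𝔮₀` may be `(π)` itself, provided `(π) ≠ ι(π)`), GIVEN
  `ι(char X) = char X` (Greenberg, LNM 1716 Thm. 1.14, ideal form) and `(ι L̃₀) = (L̃₀)` (functional equation):
  **`ℓ_{𝔮₀}(X) ≤ ℓ_{𝔮₀}(Λ/(L̃₀))`** — the first bullet at `ι𝔮₀`, transported by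
  `Kato2004.lengthAt_eq_comap_invol_of_map_invol_charIdeal_eq` and
  `Kato2004.lengthAt_quotient_span_eq_comap_invol_of_map_invol_span_eq`.

Together: Conj. 17.6's INEQUALITY `ℓ_𝔮(X) ≤ ord_𝔮(L̃₀)` at every height-one `𝔮 ∌ p` with `π ∉ 𝔮` or
`π ∉ ι𝔮` — for the motivating package, at ALL height-one `𝔮 ∌ 2`, although the package itself only gives
`ℓ_{𝔮₀}(X) ≤ 1 + ord_{𝔮₀}(L̃₀)` at `𝔮₀ = (π)`. THEOREMS ONLY (no definition, no named fact, no instance, no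
`sorry`); the named fact `Kato2004.thm12_4` (Thm. 12.4 (2): `𝐇¹_Γ` torsion free of rank `1`) is a hypothesis,
as in `katoDivisibility_splitMult_of_inputs`; nothing about any curve is asserted.

References: [Kato2004Asterisque] Thm. 12.4 (2) (p. 221), Thm. 12.5 (3) and (12.5.1) (p. 222), Conj. 17.6
(p. 274), §17.13 (pp. 279–280), 14.9 (p. 239); [GreenbergLNM1716] Thm. 1.14 (p. 68); [MazurTateTeitelbaum1986Invent]
§I.17; [Washington1997] §13.2.
-/

noncomputable section

open scoped Classical

namespace Literature.NumberTheory.EllipticCurves.Kato2004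

open Module Field Literature.NumberTheory.EllipticCurves.IwasawaAlgebra
  Literature.NumberTheory.EllipticCurves.Module

variable {W : WeierstrassCurve ℚ} [W.IsElliptic] {p : ℕ} [Fact p.Prime]
  [ContinuousSMul ℤ_[p] (W.tateModule p)] {κ : ZpExtension ℚ p} {γ : absoluteGaloisGroup ℚ}
  {I : IwasawaH1Data W p κ γ} {D : W.SelmerDualData κ γ}

/-- Lengths of `Λ/(C(p^m)·x)` and of `Λ/(x)` agree at a height-one prime `𝔮 ∌ p` (Washington §13.2:
`p` is a unit in `Λ_𝔮`). [cite: Washington1997, §13.2] -/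
theorem lengthAt_quotient_span_C_pow_mul {m : ℕ} (x : IwasawaAlgebra p)
    (𝔮 : PrimeSpectrum (IwasawaAlgebra p)) (h𝔮 : 𝔮.asIdeal.height = 1)
    (hp𝔮 : PowerSeries.C (p : ℤ_[p]) ∉ 𝔮.asIdeal) :
    lengthAt (IwasawaAlgebra p)
        (IwasawaAlgebra p ⧸ Ideal.span {PowerSeries.C ((p : ℤ_[p]) ^ m) * x}) 𝔮 =
      lengthAt (IwasawaAlgebra p) (IwasawaAlgebra p ⧸ Ideal.span {x}) 𝔮 := by
  have hC : (PowerSeries.C ((p : ℤ_[p]) ^ m) : IwasawaAlgebra p) ≠ 0 := by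
    rw [map_pow]; exact pow_ne_zero m (prime_C p).ne_zero
  rw [lengthAt_quotient_span_singleton_mul x hC 𝔮, lengthAt_quotient_C_pow m 𝔮 h𝔮, if_neg hp𝔮,
    smul_zero, zero_add]

/-- **`ℓ_𝔮(X) ≤ ℓ_𝔮(Λ/(L̃₀))` OFF the factor `π`.** Package `K : MultDivisibilityInputs W p (ι(π)·L₀) κ γ I D`
(so `ι K.G = pⁿ·ι(π)·L₀`), an integral `L̃₀ ≠ 0` with `ι L̃₀ = p^m·L₀`, Kato's Thm. 12.4 (2) (`thm12_4`) for
the binders of `I.H`; then at every height-one `𝔮 ∌ p` with `π ∉ 𝔮`: `ℓ_𝔮(D.X) ≤ ℓ_𝔮(Λ/(L̃₀))`. Proof: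
`Kato2004.lengthAt_add_le_of_skeleton_exceptional` (with `J = ⊤`: the local term of Thm. 12.5 (3) cancels
against `upTo_H2loc`) gives `ℓ_𝔮(X) ≤ ℓ_𝔮(Λ/(G))`, and `p^m·G = pⁿ·π·L̃₀` in `Λ` (apply `ι`, injective) with
`ℓ_𝔮(Λ/(p^k)) = ℓ_𝔮(Λ/(π)) = 0`. [cite: Kato2004Asterisque, Thm. 12.5 (3) (p. 222), §17.13 (pp. 279–280), 14.9 (p. 239)] -/
theorem MultDivisibilityInputs.lengthAt_X_le_off_factor (h12 : thm12_4) (hκ : κ.IsCyclotomic)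
    (hγ : κ.IsTopGenerator γ) {π : IwasawaAlgebra p} {L₀ : PowerSeries ℚ_[p]}
    (K : MultDivisibilityInputs W p (iwasawaToPowerSeries p π * L₀) κ γ I D)
    {Lt : IwasawaAlgebra p} {m : ℕ}
    (hLt : iwasawaToPowerSeries p Lt = PowerSeries.C ((p : ℚ_[p]) ^ m) * L₀) (hLt0 : Lt ≠ 0)
    (𝔮 : PrimeSpectrum (IwasawaAlgebra p)) (h𝔮 : 𝔮.asIdeal.height = 1)
    (hp𝔮 : PowerSeries.C (p : ℤ_[p]) ∉ 𝔮.asIdeal) (hπ𝔮 : π ∉ 𝔮.asIdeal) :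
    lengthAt (IwasawaAlgebra p) D.X 𝔮 ≤
      lengthAt (IwasawaAlgebra p) (IwasawaAlgebra p ⧸ Ideal.span {Lt}) 𝔮 := by
  haveI : Module.Finite (IwasawaAlgebra p) D.X := D.module_finite_of_isCyclotomic W κ hκ hγ
  obtain ⟨htf, hrank⟩ := h12.isTorsionFree_and_rank_le_one W p hκ hγ I
  haveI := htf
  obtain ⟨hc0, hc⟩ := natCast_pow_ne_zero_and_not_mem p K.a
  have hπ0 : π ≠ 0 := fun h => hπ𝔮 (h ▸ 𝔮.asIdeal.zero_mem)
  have hιπ0 : iwasawaToPowerSeries p π ≠ 0 := fun h =>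
    hπ0 (iwasawaToPowerSeries_injective p (by rw [h, map_zero]))
  have hL₀0 : L₀ ≠ 0 := by
    intro h0
    apply hLt0
    apply iwasawaToPowerSeries_injective p
    rw [hLt, h0, mul_zero, map_zero]
  have hL : iwasawaToPowerSeries p π * L₀ ≠ 0 := mul_ne_zero hιπ0 hL₀0
  have hG : K.G ≠ 0 := K.G_ne_zero hL
  have hfin : lengthAt (IwasawaAlgebra p) K.H2loc 𝔮 ≠ ⊤ :=
    ne_top_of_le_ne_top (by simp) (K.lengthAt_H2loc_le_one 𝔮 h𝔮 hp𝔮)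
  -- the §17.13 bound with the local term absorbed: `ℓ(X) + ℓ(Λ/⊤) ≤ ℓ(Λ/(G))`
  have hA := lengthAt_add_le_of_skeleton_exceptional hrank K.loc K.toX K.δ K.ε K.upTo_P K.upTo_X
    K.upTo_H2 K.upTo_H2loc K.col K.col_injective (J := ⊤) (fun _ => Submodule.mem_top) K.Z hG
    K.pow_mem 𝔮 (hc 𝔮 h𝔮 hp𝔮) hfin (K.es_bound 𝔮 h𝔮 hp𝔮)
  have hXG : lengthAt (IwasawaAlgebra p) D.X 𝔮 ≤
      lengthAt (IwasawaAlgebra p) (IwasawaAlgebra p ⧸ Ideal.span {K.G}) 𝔮 :=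
    le_trans le_self_add hA
  -- `p^m · G = p^n · π · L̃₀` in `Λ`
  have key : PowerSeries.C ((p : ℤ_[p]) ^ m) * K.G =
      PowerSeries.C ((p : ℤ_[p]) ^ K.n) * (π * Lt) := by
    apply iwasawaToPowerSeries_injective p
    rw [map_mul, map_mul, map_mul, K.ιG_eq, hLt]
    simp only [iwasawaToPowerSeries, map_pow, map_natCast]
    ring
  have hLen : lengthAt (IwasawaAlgebra p) (IwasawaAlgebra p ⧸ Ideal.span {K.G}) 𝔮 =
      lengthAt (IwasawaAlgebra p) (IwasawaAlgebra p ⧸ Ideal.span {Lt}) 𝔮 := by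
    rw [← lengthAt_quotient_span_C_pow_mul (m := m) K.G 𝔮 h𝔮 hp𝔮, key,
      lengthAt_quotient_span_C_pow_mul (m := K.n) (π * Lt) 𝔮 h𝔮 hp𝔮,
      lengthAt_quotient_span_singleton_mul Lt hπ0 𝔮,
      lengthAt_quotient_eq_zero_of_not_le (by rwa [Ideal.span_singleton_le_iff_mem]), zero_add]
  exact hLen ▸ hXG

/-- **`ℓ_{𝔮₀}(X) ≤ ℓ_{𝔮₀}(Λ/(L̃₀))` AT the factor's prime, by TRANSPORT.** Same package data; `𝔮₀ ∌ p` of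
height one such that `π ∉ ι𝔮₀` (e.g. `𝔮₀ = (π)` with `(π) ≠ ι(π)`: the exceptional prime of (12.5.1),
`π = T + 4/5`, `ι(π) ≐ T − 4`), and the two symmetries `ι(char X) = char X` (Greenberg LNM 1716 Thm. 1.14 in
ideal form — for the additive curve of the cell obtained from the theorem over `ℚ(i)` and over `ℚ` for the
twist, tree facts `Greenberg1999.thm114_charIdeal_iota_invariant_splitMult_baseChange` /
`Greenberg1999_thm114_charIdeal_iota_invariant`) and `(ι L̃₀) = (L̃₀)` (functional equation, MTT §I.17). Then
Conj. 17.6's inequality holds at `𝔮₀` SHARP — the package alone gives it only up to the length `1` of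
`Λ/(π)` there. Proof: the previous theorem at `ι𝔮₀` and `Kato2004.lengthAt_eq_comap_invol_of_map_invol_charIdeal_eq`,
`Kato2004.lengthAt_quotient_span_eq_comap_invol_of_map_invol_span_eq`.
[cite: Kato2004Asterisque, Thm. 12.5 (3) and (12.5.1) (p. 222), Conj. 17.6 (p. 274), §17.13 (pp. 279–280)]
[cite: GreenbergLNM1716, Thm. 1.14 (p. 68)] [cite: MazurTateTeitelbaum1986Invent, §I.17] -/
theorem MultDivisibilityInputs.lengthAt_X_le_at_factor_of_transport (h12 : thm12_4)
    (hκ : κ.IsCyclotomic) (hγ : κ.IsTopGenerator γ) {π : IwasawaAlgebra p} {L₀ : PowerSeries ℚ_[p]}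
    (K : MultDivisibilityInputs W p (iwasawaToPowerSeries p π * L₀) κ γ I D)
    {Lt : IwasawaAlgebra p} {m : ℕ}
    (hLt : iwasawaToPowerSeries p Lt = PowerSeries.C ((p : ℚ_[p]) ^ m) * L₀) (hLt0 : Lt ≠ 0)
    (𝔮₀ : PrimeSpectrum (IwasawaAlgebra p)) (h𝔮₀ : 𝔮₀.asIdeal.height = 1)
    (hp𝔮₀ : PowerSeries.C (p : ℤ_[p]) ∉ 𝔮₀.asIdeal)
    (hπ : π ∉ (PrimeSpectrum.comap (invol p).toRingHom 𝔮₀).asIdeal)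
    (hXι : (charIdeal (IwasawaAlgebra p) D.X).map (invol p).toRingHom =
      charIdeal (IwasawaAlgebra p) D.X)
    (hLtι : (Ideal.span {Lt}).map (invol p).toRingHom = Ideal.span {Lt}) :
    lengthAt (IwasawaAlgebra p) D.X 𝔮₀ ≤
      lengthAt (IwasawaAlgebra p) (IwasawaAlgebra p ⧸ Ideal.span {Lt}) 𝔮₀ := by
  haveI : Module.Finite (IwasawaAlgebra p) D.X := D.module_finite_of_isCyclotomic W κ hκ hγ
  set 𝔮' := PrimeSpectrum.comap (invol p).toRingHom 𝔮₀ with h𝔮'def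
  have h𝔮' : 𝔮'.asIdeal.height = 1 := by rw [h𝔮'def, height_comap_invol]; exact h𝔮₀
  have hp𝔮' : PowerSeries.C (p : ℤ_[p]) ∉ 𝔮'.asIdeal := by
    intro h
    apply hp𝔮₀
    rw [h𝔮'def, PrimeSpectrum.comap_asIdeal, Ideal.mem_comap] at h
    change invol p (PowerSeries.C (p : ℤ_[p])) ∈ 𝔮₀.asIdeal at h
    rwa [invol_C] at h
  have hA := K.lengthAt_X_le_off_factor h12 hκ hγ hLt hLt0 𝔮' h𝔮' hp𝔮' hπ
  -- `X` is torsion (from the package), so Greenberg's symmetry can be read prime by prime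
  obtain ⟨htf, hrank⟩ := h12.isTorsionFree_and_rank_le_one W p hκ hγ I
  haveI := htf
  obtain ⟨hc0, -⟩ := natCast_pow_ne_zero_and_not_mem p K.a
  have hπ0 : π ≠ 0 := fun h => hπ (h ▸ 𝔮'.asIdeal.zero_mem)
  have hιπ0 : iwasawaToPowerSeries p π ≠ 0 := fun h =>
    hπ0 (iwasawaToPowerSeries_injective p (by rw [h, map_zero]))
  have hL₀0 : L₀ ≠ 0 := by
    intro h0
    apply hLt0
    apply iwasawaToPowerSeries_injective p
    rw [hLt, h0, mul_zero, map_zero]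
  have hG : K.G ≠ 0 := K.G_ne_zero (mul_ne_zero hιπ0 hL₀0)
  obtain ⟨z, -, hz⟩ := Submodule.mem_map.mp K.pow_mem
  simp only [LinearMap.coe_comp, Function.comp_apply] at hz
  have hXtors : Module.IsTorsion (IwasawaAlgebra p) D.X :=
    isTorsion_of_skeleton_upTo hc0 K.loc K.toX K.δ K.upTo_P K.upTo_X K.col K.col_injective hG hz
      K.isTorsion_H2
  rw [lengthAt_eq_comap_invol_of_map_invol_charIdeal_eq hXtors hXι 𝔮₀ h𝔮₀,
    lengthAt_quotient_span_eq_comap_invol_of_map_invol_span_eq hLtι 𝔮₀]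
  exact hA

end Literature.NumberTheory.EllipticCurves.Kato2004

end
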